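import Summits.NavierStokesRegularity.NavierStokesRegularity.Theorems.TypeICertificateLadderTargetTypeIZoomPhysical
import Literature.Analysis.FluidPDE.KNSSLocalSmoothingHolds
import HarnessLib

/-!
# Crux `FarFieldSlaving` (stmt-NavierStokesRegularity-1935), line `registered`:
  stub `stub_vorticityTypeIRate` — the Type-I rate in time passes to the vorticity

Helper file (theorems only) towards the thesis `FarFieldSlaving` of route HubbleDynamo. For
`ν > 0`, `T > 0` and a classical solution `(u, p)` of the unforced Navier–Stokes system on
`ℝ³ × [0, T)` which is Leray–Hopf on `[0, T)` from its rapidly decaying datum `u 0` and blows up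
at `T` with the Type-I rate in time, `‖u(t, x)‖ ≤ C/√(T − t)` eventually as `t ↑ T`, the
vorticity obeys the parabolic core bound `‖curl u(t, x)‖ ≤ A/(T − t)` for all `x` and all `t < T`
near `T`.

Proof (Koch–Nadirashvili–Seregin–Šverák 2009, Prop. 4.1 with (4.5)/(4.6), `k = 1`, `l = 0`:
parabolic smoothing of bounded mild solutions). Fix `t` in the rate window and restart at
`s = t − κ(T − t)`: on `[s, (t + T)/2] × ℝ³` the rate gives `‖u‖ ≤ M := C√2/√(T − t)`; the
smooth local solution `v` of the Oseen integral equation from the datum `u s` lives on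
`(s, s + εν/M²) ∋ t` (choice `κ = εν/(4C²)`) with `√(ν(t − s)) ‖∇v(t, x)‖ ≤ C' M`
(`knss2009_local_smoothing_holds`); `u` solves the same equation pointwise
(`typeIZoom_oseen_pairs`), so `u t = v t` by uniqueness of bounded solutions
(`exists_local_smooth_representative`), and `‖curl u(t, x)‖ ≤ 4‖∇u(t, x)‖ ≤ A/(T − t)`.

Lands `--supports stmt-NavierStokesRegularity-1935` (registered stub `stub_vorticityTypeIRate`).
-/

noncomputable section

-- the summit and its single sub-problem share the name (CONVENTIONS §1), as in every Theorems file
set_option linter.dupNamespace false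

namespace Summit.NavierStokesRegularity.NavierStokesRegularity.Theorems.FarFieldSlaving.Birth

open MeasureTheory Set Filter Topology Function Metric
open scoped RealInnerProductSpace NNReal ENNReal
open Literature.Analysis Literature.Analysis.FluidPDE
open Summit.NavierStokesRegularity.NavierStokesRegularity.Theorems

/-- **The Type-I rate in time passes to the vorticity** (KNSS 2009, Prop. 4.1 / (4.6) with
`k = 1`: parabolic smoothing of bounded mild solutions, applied on the windows
`s = t − κ(T − t)`). For `ν > 0`, `T > 0`, `(u, p)` classical on `ℝ³ × [0, T)`, Leray–Hopf from
its rapidly decaying datum, with `IsTypeIBlowup u T`: there are `t₀ < T` and `A` with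
`‖curl u(t, x)‖ ≤ A/(T − t)` for all `t ∈ (t₀, T)` and all `x`.
[cite: KochNadirashviliSereginSverak2009, Prop. 4.1 with (4.5)–(4.6) (arXiv:0709.3599 p. 8)] -/
theorem stub_vorticityTypeIRate :
    ∀ (ν T : ℝ), 0 < ν → 0 < T →
      ∀ (u : ℝ → EuclideanSpace ℝ (Fin 3) → EuclideanSpace ℝ (Fin 3))
        (p : ℝ → EuclideanSpace ℝ (Fin 3) → ℝ),
        Literature.Analysis.FluidPDE.IsClassicalNSSolutionOn (Set.Ico 0 T) ν 0 u p →
        Literature.Analysis.FluidPDE.IsLerayHopfOn T ν 0 (u 0) u →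
        Literature.Analysis.FluidPDE.HasRapidSpatialDecay (u 0) →
        Literature.Analysis.FluidPDE.IsTypeIBlowup u T →
        ∃ t₀ : ℝ, t₀ < T ∧ ∃ A : ℝ, ∀ t ∈ Set.Ioo t₀ T, ∀ x : EuclideanSpace ℝ (Fin 3),
          ‖Literature.Analysis.FluidPDE.curl (u t) x‖ ≤ A / (T - t) := by
  intro ν T hν hT u p hcl hLH hdec hTI
  haveI : Nontrivial (EuclideanSpace ℝ (Fin 3)) := inferInstance
  -- ### Step 0: continuity and measurability of the classical solution
  have hcont : ContinuousOn (uncurry u) (Ico 0 T ×ˢ univ) := hcl.smooth_velocity.continuousOn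
  have hslice : ∀ τ ∈ Ico 0 T, Continuous (u τ) := fun τ hτ =>
    hcont.comp_continuous (Continuous.prodMk_right τ) fun x => ⟨hτ, mem_univ x⟩
  have hmeasIoo : ∀ a b : ℝ, 0 ≤ a → b ≤ T → AEStronglyMeasurable (uncurry u)
      ((volume : Measure (ℝ × EuclideanSpace ℝ (Fin 3))).restrict (Ioo a b ×ˢ univ)) :=
    fun a b ha hb => (hcont.mono (prod_mono (fun τ hτ => ⟨ha.trans hτ.1.le, hτ.2.trans_le hb⟩)
      Subset.rfl)).aestronglyMeasurable (measurableSet_Ioo.prod MeasurableSet.univ)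
  -- ### Step 1: the rate window `(T', T)`, `0 < T'`, with a positive rate constant `C₁`
  obtain ⟨C, hC⟩ := hTI
  obtain ⟨T₀, hT₀T, hT₀⟩ := mem_nhdsLT_iff_exists_Ioo_subset.1 hC
  set C₁ : ℝ := max C 1 with hC₁
  have hC₁pos : 0 < C₁ := lt_max_of_lt_right one_pos
  set T' : ℝ := max T₀ (T / 2) with hT'
  have hT'T : T' < T := max_lt hT₀T (by linarith)
  have hT'pos : 0 < T' := lt_of_lt_of_le (by linarith) (le_max_right _ _)
  have hrate : ∀ τ ∈ Ioo T' T, ∀ x, ‖u τ x‖ ≤ C₁ / Real.sqrt (T - τ) := by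
    intro τ hτ x
    have h := hT₀ ⟨lt_of_le_of_lt (le_max_left _ _) hτ.1, hτ.2⟩ x
    exact h.trans (div_le_div_of_nonneg_right (le_max_left _ _) (Real.sqrt_nonneg _))
  -- ### Step 2: the local smoothing constants for `k = 1`, `l = 0`, the window ratio `κ`, `t₀`
  obtain ⟨ε, hε, Cs, hCs, hL⟩ := knss2009_local_smoothing_holds (EuclideanSpace ℝ (Fin 3)) 1 0
  set κ : ℝ := ε * ν / (4 * C₁ ^ 2) with hκ
  have hκpos : 0 < κ := by positivity
  set t₀ : ℝ := (T' + κ * T) / (1 + κ) with ht₀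
  have h1κ : 0 < 1 + κ := by positivity
  have ht₀T : t₀ < T := by
    rw [ht₀, div_lt_iff₀ h1κ]; nlinarith
  have hT't₀ : T' ≤ t₀ := by
    rw [ht₀, le_div_iff₀ h1κ]; nlinarith
  set A : ℝ := 4 * (Cs * (C₁ * Real.sqrt 2)) / Real.sqrt (ν * κ) with hA
  refine ⟨t₀, ht₀T, A, fun t ht x => ?_⟩
  -- ### Step 3: the window `(s, T₁)`, `s = t - κ (T - t)`, `T₁ = (t + T)/2`, and the bound `Mp`
  set d : ℝ := T - t with hd
  have hdpos : 0 < d := sub_pos.2 ht.2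
  set s : ℝ := t - κ * d with hs
  have hst : s < t := by rw [hs]; nlinarith
  have hT's : T' < s := by
    have h1 : t₀ < t := ht.1
    rw [ht₀, div_lt_iff₀ h1κ] at h1
    rw [hs, hd]; nlinarith
  have hspos : 0 < s := hT'pos.trans hT's
  set T₁ : ℝ := (t + T) / 2 with hT₁
  have htT₁ : t < T₁ := by rw [hT₁]; linarith [ht.2]
  have hT₁T : T₁ < T := by rw [hT₁]; linarith [ht.2]
  set Mp : ℝ := C₁ * Real.sqrt 2 / Real.sqrt d with hMp
  have hsqd : 0 < Real.sqrt d := Real.sqrt_pos.2 hdpos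
  have hMppos : 0 < Mp := by positivity
  -- the rate bound on `[s, T₁]` is below `Mp`
  have hMpbd : ∀ τ, s ≤ τ → τ ≤ T₁ → ∀ y, ‖u τ y‖ ≤ Mp := by
    intro τ hsτ hτT₁ y
    have hτT : τ < T := hτT₁.trans_lt hT₁T
    have hTτ : 0 < T - τ := sub_pos.2 hτT
    have hsqτ : 0 < Real.sqrt (T - τ) := Real.sqrt_pos.2 hTτ
    refine (hrate τ ⟨hT's.trans_le hsτ, hτT⟩ y).trans ?_
    rw [hMp, div_le_div_iff₀ hsqτ hsqd]
    have h2 : Real.sqrt d ≤ Real.sqrt 2 * Real.sqrt (T - τ) := by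
      rw [← Real.sqrt_mul (by norm_num : (0 : ℝ) ≤ 2)]
      refine Real.sqrt_le_sqrt ?_
      rw [hd]; rw [hT₁] at hτT₁; linarith
    calc C₁ * Real.sqrt d ≤ C₁ * (Real.sqrt 2 * Real.sqrt (T - τ)) :=
          mul_le_mul_of_nonneg_left h2 hC₁pos.le
      _ = C₁ * Real.sqrt 2 * Real.sqrt (T - τ) := by ring
  have hMptop : ∀ τ, s ≤ τ → τ ≤ T₁ → eLpNorm (u τ) ∞ volume ≤ ENNReal.ofReal Mp := by
    intro τ hsτ hτT₁
    rw [eLpNorm_exponent_top]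
    exact eLpNormEssSup_le_of_ae_bound (ae_of_all _ (hMpbd τ hsτ hτT₁))
  -- the length of the local window: `ε ν / Mp² = 2 κ d > t - s = κ d`
  have hMp2 : Mp ^ 2 = 2 * C₁ ^ 2 / d := by
    rw [hMp, div_pow, mul_pow, Real.sq_sqrt (by norm_num : (0 : ℝ) ≤ 2), Real.sq_sqrt hdpos.le]
    ring
  have hwin : ε * ν / Mp ^ 2 = 2 * κ * d := by
    rw [hMp2, hκ]
    field_simp
    norm_num
  have htwin : t < s + ε * ν / Mp ^ 2 := by
    rw [hwin, hs]; nlinarith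
  -- ### Step 4: the smooth local representative from the datum `u s` at time `s` equals `u`
  have hoseen : ∀ τ ∈ Ioo s T₁, u τ =ᵐ[volume] fun y =>
      UnboundedOperators.heatExtension (u s) (ν * (τ - s)) y - oseenDuhamel ν s u u τ y :=
    fun τ hτ => Eventually.of_forall fun y =>
      typeIZoom_oseen_pairs ν T u p hν hT hcl hLH hdec s τ hspos hτ.1 (hτ.2.trans hT₁T) y
  obtain ⟨v, -, -, hrep, -, hvbd⟩ := exists_local_smooth_representative hL hν hMppos hCs
    ((hslice s ⟨hspos.le, hst.trans ht.2⟩).aestronglyMeasurable) (hMptop s le_rfl (hst.trans htT₁).le)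
    (hmeasIoo s T₁ hspos.le hT₁T.le) (fun τ hτ => hMptop τ hτ.1.le hτ.2.le) hoseen
  have htw : t ∈ Ioo s (min (s + ε * ν / Mp ^ 2) T₁) := ⟨hst, lt_min htwin htT₁⟩
  have huv : u t = v t := by
    funext y
    rw [← hrep t htw y]
    exact typeIZoom_oseen_pairs ν T u p hν hT hcl hLH hdec s t hspos hst ht.2 y
  -- ### Step 5: the gradient bound at `(t, x)` and the vorticity bound
  have hb := hvbd t ⟨hst, htwin⟩ x
  simp only [iteratedDeriv_zero, Nat.cast_one, pow_zero, mul_one] at hb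
  rw [norm_iteratedFDeriv_one, ← Real.sqrt_eq_rpow] at hb
  -- `hb : √(ν (t - s)) * ‖fderiv ℝ (v t) x‖ ≤ Cs * Mp`
  have hts : t - s = κ * d := by rw [hs]; ring
  rw [hts] at hb
  have hνκ : 0 < Real.sqrt (ν * κ) := Real.sqrt_pos.2 (mul_pos hν hκpos)
  have hW : Real.sqrt (ν * (κ * d)) = Real.sqrt (ν * κ) * Real.sqrt d := by
    rw [← mul_assoc, Real.sqrt_mul (mul_pos hν hκpos).le]
  rw [hW] at hb
  have hWpos : 0 < Real.sqrt (ν * κ) * Real.sqrt d := mul_pos hνκ hsqd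
  have hgrad : ‖fderiv ℝ (u t) x‖ ≤ Cs * Mp / (Real.sqrt (ν * κ) * Real.sqrt d) := by
    rw [huv, le_div_iff₀ hWpos, mul_comm]
    exact hb
  have hkey : Cs * Mp / (Real.sqrt (ν * κ) * Real.sqrt d) = (Cs * (C₁ * Real.sqrt 2)) /
      Real.sqrt (ν * κ) / d := by
    rw [hMp]
    have hdd : Real.sqrt d ^ 2 = d := Real.sq_sqrt hdpos.le
    field_simp
    rw [hdd]
  calc ‖curl (u t) x‖ ≤ 4 * ‖fderiv ℝ (u t) x‖ := norm_curl_le_four_mul _ _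
    _ ≤ 4 * (Cs * Mp / (Real.sqrt (ν * κ) * Real.sqrt d)) :=
        mul_le_mul_of_nonneg_left hgrad (by norm_num)
    _ = A / d := by rw [hkey, hA]; ring

end Summit.NavierStokesRegularity.NavierStokesRegularity.Theorems.FarFieldSlaving.Birth

end
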